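import Summits.QuantumFields.YangMills.Theorems.UnitScaleTiltHistoryTailOfPackageV3MassEnvelope
import Summits.QuantumFields.YangMills.Theorems.UV3PinnedMassEnvelopeV3OfN08
import HarnessLib

/-!
# THE 19936 CRUX FACE IN THE v3 CURRENCY OVER ONE KINEMATIC ROW: `UnitScaleTilt.HistoryTailL` FROM THE v3 (α) SOCKET, THE POLYMER FIELDS AND
# hTop (Haar pushed through every averaging segment `j … K` has density `≤ e^{c}` w.r.t. Haar, `c` uniform in the run) — or hTopB (the same for `blockAvg ℰp` itself) — or hN08 (the weak-closure letter)

Cell `ym3-torus` (YM ladder rung R3 = continuum `SU(2)` Yang–Mills on the three-torus — a RUNG, NOT d = 4, NOT infinite volume, NOT a mass gap, NOT Clay).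
Twin-width seat `ym-ust-19936-w8` (gen 11); `--supports stmt-QuantumFields-19936 --as helper`, count-neutral, definition-free, default heartbeats.
Crux `UnitScaleTilt.HistoryTailL` (stmt-QuantumFields-19936).  `ym-ust-19936-w6` g7 2026-08-30T01:30:21Z (✓`UV3PinnedMassEnvelopeV3OfN08`, ★★OWNER WORD 72): «w8 g11: your v3 face composes over
{hpkg-v3 (guarded), π, hTop} or {hpkg-v3, π, hN08} with NO hMain∕hTriv (your one-liner)» — these are the one-liners.

★★★★ `historyTailL_of_packageV3_of_topHaarPushforward (hpkg) (π) (hTop)`: `HistoryTailL` ⟸ the UV3 node's v3 (α) package (guarded, ★★OWNER RULING №38) ∧ polymer fields (data) ∧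
**hTop** = `∀ F : T3Family, ∃ c ≥ 0, ∀ K j n, j + n = K → (fieldMeasure (F.P K) j SU(2)).map (iterFrom (avT3 F K) j n) ≤ ofReal (exp c) • fieldMeasure (F.P K) (j+n) SU(2)` — ONE kinematic
measure inequality per family (no histories, weights, Z-terms, floors, constants records or couplings in it): in print an EQUALITY with `c = 0` by the Haar compatibility of Bałaban's
averaging ([Balaban1985UV3] (5) p.256 and [7] of its bibliography); OPEN for the tree's `blockAvg ℰp` (lit GAPS G-B10-10(c)) — ★★OWNER WORD 68's v5-candidate row, `ym-ust-19936-w3`'s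
K-23-TOP binder.  Twins: ★★★ `…_of_topBlockAvgPushforward (hpkg) (π) (hTopB)` (the same row written for `blockAvg ℰp` directly, `ym3-torus-px8` g12's letter) and ★★★
`…_of_weakClosed_avT3 (hpkg) (π) (hN08)` (the N08 seat's weak-closure letter with slack `e^{A₁} − 1`).
Composition, all by name: ✓`UnitScaleTiltHistoryTailOfPackageV3MassEnvelope.historyTailL_of_packageV3_of_massEnvelope (hpkg)(π)(hJ)` (this seat, ✓p754390: S-face v3 ∘ v3 KNIT ∘ w6 S-v3;
px12 U-face v3 ∘ w6 §U-v3; door; the LEAD's K-19′ socket) with `hJ := h.hJ_of_topHaarPushforward F 𝔠 γ hγ hγ1 hc (hTop F)` ∕ `h.hJ_of_topBlockAvgPushforward … (hTopB F)` ∕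
`h.hJ_of_weakClosed_avT3 … hA₁ hN08'` (w6 g7 ✓`UV3PinnedMassEnvelopeV3OfN08` over `ym3-torus-px8` g12 ✓`UV3StartClosedOfTopHaarPushforward` and `dag-n08-d` g47 ✓`BalabanUVNodesN08KFoldTransportEnvelopeT3`).

HONEST SCOPE.  Faces; they close nothing — hTop ∕ hTopB ∕ hN08 and the v3 socket are DISPLAYED, not proved; nothing of `stub_pinnedStep`, `stub_unitEnvelope`, `hP′`, `HistoryTailL` (19936) or the
rung is proved here.  Sorry-free, axioms standard.

References: T. Bałaban, *Ultraviolet stability of three-dimensional lattice pure gauge field theories*, Commun. Math. Phys. **102** (1985) 255–275 [Balaban1985UV3]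
((5) p.256, (41) p.266, (47) p.267, (70)–(71) p.273).
-/

set_option autoImplicit false

noncomputable section

namespace Summit.QuantumFields.YangMills.Theorems.UnitScaleTiltHistoryTailOfPackageV3TopHaarPushforward

open scoped ENNReal
open MeasureTheory
open Literature.MathematicalPhysics.QuantumFieldTheory.Balaban1983to89
open Literature.MathematicalPhysics.QuantumFieldTheory.Balaban1983to89.T3ContinuumYM3Torus
open Literature.MathematicalPhysics.QuantumFieldTheory.Balaban1983to89.T3UnitLawDensityEML (ℰp)
open Literature.MathematicalPhysics.QuantumFieldTheory.Balaban1983to89.T4AvgSensitivity (iterFrom)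
open Literature.MathematicalPhysics.QuantumFieldTheory.Balaban1985CMP102
open Literature.MathematicalPhysics.QuantumFieldTheory.Balaban1985CMP102.Setting
open Summit.QuantumFields.Balaban3D.Carriers
open Summit.QuantumFields.Balaban3D.Proofs.Primitives
open Summit.QuantumFields.YangMills.Theorems.UnitScaleTiltHistoryTailOfPackageV3MassEnvelope (historyTailL_of_packageV3_of_massEnvelope)

/-- ★★★★ **`UnitScaleTilt.HistoryTailL` FROM THE v3 (α) SOCKET, THE POLYMER FIELDS AND THE TOP HAAR-PUSHFORWARD ROW hTop** (one kinematic measure inequality per family; in print an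
equality with `c = 0` by Haar compatibility; OPEN for `blockAvg ℰp`).  `hJ(v3) := h.hJ_of_topHaarPushforward … (hTop F)` (w6 g7), then ✓`historyTailL_of_packageV3_of_massEnvelope`.
CONDITIONAL — a face; it does NOT prove `HistoryTailL`. [cite: Balaban1985UV3, (5) p.256, (41) p.266, (47) p.267, (70)-(71) p.273] -/
theorem historyTailL_of_packageV3_of_topHaarPushforward
    (hpkg : ∀ L : ℕ, 1 < L → ∃ (𝔠 : AlphaConsts L (suGroupModel 2).N) (a₀ a₁ : ℝ),
      (0 < a₀ ∧ 0 < a₁ ∧ 𝔠.B₃ * a₁ ≤ a₀) ∧ ∀ (F : T3Family) (hF : F.L = L), AlphaInputsT3AC.OfV3At F (hF ▸ 𝔠) a₀ a₁)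
    (π : ∀ F : T3Family, AlphaInputsT3AC.PolymerT3 F)
    (hTop : ∀ F : T3Family, ∃ c : ℝ, 0 ≤ c ∧ ∀ (K j n : ℕ), j + n = K →
      (fieldMeasure (F.P K) j (Matrix.specialUnitaryGroup (Fin 2) ℂ)).map (iterFrom (avT3 F K) j n) ≤
        ENNReal.ofReal (Real.exp c) • fieldMeasure (F.P K) (j + n) (Matrix.specialUnitaryGroup (Fin 2) ℂ)) :
    Summit.QuantumFields.YangMills.Theses.UnitScaleTilt.HistoryTailL :=
  historyTailL_of_packageV3_of_massEnvelope hpkg π fun F 𝔠 _ _ h hc γ hγ hγ1 =>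
    h.hJ_of_topHaarPushforward F 𝔠 γ hγ hγ1 hc (hTop F)

/-- ★★★ **`UnitScaleTilt.HistoryTailL` FROM THE v3 (α) SOCKET, THE POLYMER FIELDS AND THE TOP `blockAvg ℰp`-PUSHFORWARD ROW hTopB** (the same row written for the block
averaging `ℰp` itself; `avT3 F K` agrees with it in range).  CONDITIONAL — a face. [cite: Balaban1985UV3, (5) p.256, (41) p.266, (47) p.267, (70)-(71) p.273] -/
theorem historyTailL_of_packageV3_of_topBlockAvgPushforward
    (hpkg : ∀ L : ℕ, 1 < L → ∃ (𝔠 : AlphaConsts L (suGroupModel 2).N) (a₀ a₁ : ℝ),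
      (0 < a₀ ∧ 0 < a₁ ∧ 𝔠.B₃ * a₁ ≤ a₀) ∧ ∀ (F : T3Family) (hF : F.L = L), AlphaInputsT3AC.OfV3At F (hF ▸ 𝔠) a₀ a₁)
    (π : ∀ F : T3Family, AlphaInputsT3AC.PolymerT3 F)
    (hTopB : ∀ F : T3Family, ∃ c : ℝ, 0 ≤ c ∧ ∀ (K j n : ℕ), j + n = K →
      (fieldMeasure (F.P K) j (Matrix.specialUnitaryGroup (Fin 2) ℂ)).map
          (iterFrom (fun i => BlockAveraging.blockAvg (P := F.P K) (G := Matrix.specialUnitaryGroup (Fin 2) ℂ) (j := i) ℰp) j n) ≤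
        ENNReal.ofReal (Real.exp c) • fieldMeasure (F.P K) (j + n) (Matrix.specialUnitaryGroup (Fin 2) ℂ)) :
    Summit.QuantumFields.YangMills.Theses.UnitScaleTilt.HistoryTailL :=
  historyTailL_of_packageV3_of_massEnvelope hpkg π fun F 𝔠 _ _ h hc γ hγ hγ1 =>
    h.hJ_of_topBlockAvgPushforward F 𝔠 γ hγ hγ1 hc (hTopB F)

/-- ★★★ **`UnitScaleTilt.HistoryTailL` FROM THE v3 (α) SOCKET, THE POLYMER FIELDS AND THE N08 WEAK-CLOSURE LETTER hN08** (per family: a slack `A₁ ≥ 0` and, for every run `K`,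
defect measures `ν k ≤ (e^{A₁} − 1)·Haar` with `(Haar_k + ν k).map avg_k ≤ Haar_{k+1} + ν (k+1)`).  CONDITIONAL — a face. [cite: Balaban1985UV3, (5) p.256, (41) p.266, (47) p.267, (70)-(71) p.273] -/
theorem historyTailL_of_packageV3_of_weakClosed_avT3
    (hpkg : ∀ L : ℕ, 1 < L → ∃ (𝔠 : AlphaConsts L (suGroupModel 2).N) (a₀ a₁ : ℝ),
      (0 < a₀ ∧ 0 < a₁ ∧ 𝔠.B₃ * a₁ ≤ a₀) ∧ ∀ (F : T3Family) (hF : F.L = L), AlphaInputsT3AC.OfV3At F (hF ▸ 𝔠) a₀ a₁)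
    (π : ∀ F : T3Family, AlphaInputsT3AC.PolymerT3 F)
    (hN08 : ∀ F : T3Family, ∃ A₁ : ℝ, 0 ≤ A₁ ∧ ∀ K : ℕ, ∃ ν : ∀ k, Measure (GaugeField (F.P K) k (Matrix.specialUnitaryGroup (Fin 2) ℂ)),
      (∀ k, k < K → (fieldMeasure (F.P K) k _ + ν k).map (avT3 F K k).avg ≤ fieldMeasure (F.P K) (k + 1) _ + ν (k + 1)) ∧
      (∀ k, k ≤ K → ν k ≤ ENNReal.ofReal (Real.exp A₁ - 1) • fieldMeasure (F.P K) k _)) :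
    Summit.QuantumFields.YangMills.Theses.UnitScaleTilt.HistoryTailL :=
  historyTailL_of_packageV3_of_massEnvelope hpkg π fun F 𝔠 _ _ h hc γ hγ hγ1 => by
    obtain ⟨A₁, hA₁, hN⟩ := hN08 F
    exact h.hJ_of_weakClosed_avT3 F 𝔠 γ hγ hγ1 hc hA₁ hN

end Summit.QuantumFields.YangMills.Theorems.UnitScaleTiltHistoryTailOfPackageV3TopHaarPushforward

end
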